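import Summits.BirchSwinnertonDyer.Rank1Residual.X11b.BDPRouteHalvesClass
import Summits.BirchSwinnertonDyer.Rank1Residual.X11b.BDPRouteTamagawaDefect
import Summits.BirchSwinnertonDyer.Rank1Residual.X2.TwistTamagawa
import Literature.NumberTheory.EllipticCurves.Rank1Residual.ClassX1KellerYin
import HarnessLib

/-!
# Class X11b, route "BDP + converse-theorem engine + Kolyvagin" at EVERY ODD PRIME (`p = 3` included) — data level (cell `b2b-bsdres`, sub-cell `multr1-p2`, gen 4)

HONEST FRAMING (cell `b2b-bsdres`, run/shared/lean/b2b/bsd-rank1-residual/, verbatim in every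
file): the goal of the cell is to DELETE the COMBINATION-SHAPED residual classes of the
Birch–Swinnerton-Dyer formula for ALL analytic-rank `≤ 1` elliptic curves over `ℚ` — "full BSD
formula for every rank `≤ 1` curve in class `C`" assembled STRICTLY from published theorems — so
that the rank-`≤ 1` remainder becomes exactly the CONSTRUCTION-SHAPED classes, which are TYPED
(missing-input `Prop`s), NOT attempted. This is not "finishing BSD". Sub-cell `multr1-p2` is a
RESEARCH ROUTE on class X11b (`ClassX11b W p := r_an = 1 ∧ p ≠ 2 ∧ mult(p) ∧ irr(p)`,
`Partition/Rows.lean`); no claim beyond the stated class and loci; X11b's label does not change.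

THEOREMS ONLY (no definition, no named fact). Gens 1–3 of the route (`BDPRoute*.lean`) carry the
standing hypothesis `p ≥ 5` (the route's `Locus := 5 ≤ p ∧ Ram ∧ p ∤ ∏c_ℓ`). Exactly TWO steps used
it: transport (d) `ord_p ∏_ℓ c_ℓ(E^{d_K}) = ord_p ∏_ℓ c_ℓ(E)` (`padicValNat_tamagawaProduct_twist_of_heegner`:
`c_ℓ(E^{d_K}) ≤ 4 < p` at the primes `ℓ ∤ N` ramified in `K`), and the auxiliary field of
Friedberg–Hoffstein (in which `2` may ramify, so that `c_2(E^{d_K}) = 3` is possible). Every other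
input is printed for all odd `p`: Kolyvagin 1990 Thm. A (`p` odd, `ρ̄_{E,p}` onto — McCallum 1991 §1),
`ρ̄` onto from (irr) + (ram) (`surj_of_irr_of_ram`, Serre 1972 Prop. 15, no bound on `p`), Skinner
2016 Thm. C ("a prime `p ≥ 3`", footnote 1 for `p = 3`), Mazur 1978 Cor. 4.1 (`p` odd), Gross–Zagier,
the exact odd-`p` descent `K → ℚ` (`BDPRouteDescent`, `BDPRouteShaAn`: `p ≠ 2`, `p ∤ #𝓞_K^×`).
This file removes the two obstructions with tree theorems of the neighbouring sub-cells:

* transport (d) at every odd `p` for a Heegner field with `d_K` ODD — the eisenstein-p2 sub-cell's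
  `X2.padicValNat_tamagawaProduct_twist_of_heegner_of_odd` (at `ℓ ∤ N`, `ℓ ∣ d_K`, `ℓ ≥ 3` the twist
  is of Kodaira type `I₀*`, `c_ℓ ∈ {1,2,4}`; Jetchev–Skinner–Wan 2017 (eq:tamK));
* the auxiliary field with `d_K ≡ 1 (mod 8)`, `d_K < −4`, every `ℓ ∣ N·p` split and
  `L(E^{d_K},1) ≠ 0` — the x1a seat's `exists_admissibleField_of_rootNumber_eq_neg_one`, from the
  PUBLISHED named fact `HoffsteinLuo1997_exists_twist_L_one_ne_zero` (Hoffstein–Luo 1997, Theorem)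
  and modularity (sign `−1` from `r_an = 1`).

CONTENTS (data level; the class-level theorems and the `p = 3` corollaries are
`X11b/BDPRouteOddPrimeClass.lean`):
* `exists_maninDatum_of_odd` — the Manin-unit Heegner datum (`p ∤ c`) at an odd multiplicative
  irreducible `p` (`exists_maninDatum` with `5 ≤ p` weakened to `p ≠ 2`);
* `halves_of_heegnerData_of_odd` — at fixed Heegner data with `d_K` odd and `p ∤ d_K`: STEP L ⇒ the
  main-conjecture half; `p ∤ ∏c_ℓ` + a Kolyvagin-shape bound ⇒ the Euler-system half (every odd `p`);
* `padicValNat_shaOrder_le_add_of_heegnerData_of_odd` — Kolyvagin's Tamagawa defect at such data;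
* `exists_oddHeegnerData` — the route's data for a pair (Hoffstein–Luo field, Manin-unit datum, minimal
  twist model) from the published named facts `hnf`, `hHL`, `hMaz`, `hNS`.
Nothing is booked; X11b and X11 (`p = 3`) stay CONSTRUCTION-SHAPED.

References: [JetchevSkinnerWan2017] §7.4.1–7.4.2 (pp. 29–31); [Skinner2016PacificMC] Thm. C,
footnote 1, §2.5; [KolyvaginEulerSystems1990] Thm. A; [McCallumLMS1991] §1; [Mazur1978] Cor. 4.1;
[HoffsteinLuo1997] Theorem (§1); [Serre1972] Prop. 15; [Miller2011LMS] Def. 1.1.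
-/

noncomputable section

open scoped Classical

open WeierstrassCurve NumberField Literature.NumberTheory.EllipticCurves
  Literature.NumberTheory.EllipticCurves.ModularForms
  Literature.NumberTheory.EllipticCurves.Rank1Residual

namespace Summit.BirchSwinnertonDyer.Rank1Residual.X11b

/-! ### Data level: the Manin-unit datum and the two halves at an odd prime -/

/-- **The Manin-unit Heegner datum at an ODD prime** (`BDPRouteManin.exists_maninDatum` with its
hypothesis `5 ≤ p` replaced by `p ≠ 2`, which is all its proof uses): for `W/ℚ` globally minimal of
conductor `N`, `p` odd and multiplicative (so `p² ∤ N`), `E[p]` irreducible, and `K` imaginary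
quadratic with the Heegner hypothesis for `N`, there are a parametrisation datum `Dt` at level `N`
with `p ∤ c(Dt)` (optimal curve by modularity `hnf` + Mazur 1978 Cor. 4.1 `hMaz` + a cyclic
prime-to-`p` isogeny, Néron mapping property `hNS`: `exists_modularParametrizationData_not_dvd`), a
Heegner datum `H` of discriminant `d_K`, and a point `P ∈ E(K)` mapping to the complex Heegner point
of `(Dt, H)` (Gross 1984 / Darmon 2004 Thm. 3.6, tree theorem `heegnerPointComplex_mem_range_map_holds`).
[cite: Mazur1978, Cor. 4.1] [cite: Darmon2004, Thm. 3.6–3.7 (PDF pp. 43–44)] -/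
theorem exists_maninDatum_of_odd (hnf : exists_isNewformOf)
    (hMaz : mazur_not_dvd_maninConstant_of_odd) (hNS : integral_neronScaling_of_isGloballyMinimal) :
    ∀ (W : WeierstrassCurve ℚ) [W.IsElliptic] [W.IsGloballyMinimal] (p : ℕ) [Fact p.Prime]
      (N : ℕ) [NeZero N] (K : Type) [Field K] [NumberField K],
      W.conductorNorm ℤ = N → p ≠ 2 → W.HasMultiplicativeReductionAtPrime p →
      W.HasIrreducibleModPGaloisRep p → IsImaginaryQuadratic K → SatisfiesHeegnerHypothesis N K →
      ∃ (Dt : ModularParametrizationData W N) (H : HeegnerDatum N (NumberField.discr K))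
        (ι : K →+* ℂ) (P : (W.baseChange K).toAffine.Point),
        WeierstrassCurve.Affine.Point.map ι.toRatAlgHom P = heegnerPointComplex Dt H ∧
          ¬ (p : ℤ) ∣ Dt.c := by
  intro W _ _ p _ N _ K _ _ hN hp2 hmult hirr hK hH
  have hp : p.Prime := Fact.out
  have hpN : ¬ p ^ 2 ∣ N := hN ▸ not_sq_dvd_conductorNorm_of_mult W p hmult
  obtain ⟨Dt, hDt⟩ := exists_modularParametrizationData_not_dvd hnf hMaz hNS W hN hp hp2 hpN hirr
  obtain ⟨β, hβ⟩ := exists_dvd_sq_sub_discr_holds N K hK hH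
  obtain ⟨H, -⟩ := nonempty_heegnerDatum_holds N K hK hβ
  obtain ⟨ι⟩ : Nonempty (K →+* ℂ) := inferInstance
  obtain ⟨P, hP⟩ := heegnerPointComplex_mem_range_map_holds N W K hK hH Dt H ι
  exact ⟨Dt, H, ι, P, hP, hDt⟩

/-- **The two halves at a pair of X11b with a (ram) prime, at fixed Heegner data with `d_K` ODD —
every odd prime `p`** (`halves_of_heegnerData` with `5 ≤ p` replaced by `p ≠ 2` + `d_K` odd +
`p ∤ d_K`). Data: `W/ℚ` globally minimal of conductor `N`, `ord_{s=1} L(E,s) = 1`, `p` odd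
multiplicative with `E[p]` irreducible and a (ram) prime; `K` imaginary quadratic, `d_K` odd, `p ∤ d_K`,
Heegner hypothesis for `N`, `p ∤ #𝓞_K^×`, `L(E^{d_K},1) ≠ 0`; `P` the Heegner point of a datum `Dt`
with `p ∤ c`; `Wd = Cd • W^{(d_K)}` a globally minimal model of the twist. PUBLISHED binders `hGZ`,
`hKo`, `hSk` (Skinner 2016 Thm. C for `Wd` — `p ≥ 3`, multiplicative at `p`, irreducible, (ram),
transported from `W` by `TwistTransport*.lean`), `hGZK`, `hmod`. Transport (d) at odd `p` is
`X2.padicValNat_tamagawaProduct_twist_of_heegner_of_odd`, (e) is `padicValRat_u_eq_zero_of_twist_minimal`.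
CONCLUSION: (1) STEP L at `P` ⇒ `Typed.MissingLowerBoundAt W p` (no Tamagawa condition);
(2) `p ∤ ∏_ℓ c_ℓ(E)` and a bound of Kolyvagin's shape over `K` ⇒ `Typed.MissingUpperBoundAt W p`.
[cite: JetchevSkinnerWan2017, §7.4.1–7.4.2 (pp. 30–31) and (eq:tamK)]
[cite: Skinner2016PacificMC, Thm. C (§1) and footnote 1] [cite: Miller2011LMS, Def. 1.1] -/
theorem halves_of_heegnerData_of_odd
    (W : WeierstrassCurve ℚ) [W.IsElliptic] [W.IsGloballyMinimal] (p : ℕ) [Fact p.Prime]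
    [NeZero (W.conductorNorm ℤ)] (K : Type) [Field K] [NumberField K]
    (Dt : ModularParametrizationData W (W.conductorNorm ℤ))
    (H : HeegnerDatum (W.conductorNorm ℤ) (NumberField.discr K)) (ι : K →+* ℂ)
    (P : (W.baseChange K).toAffine.Point)
    -- the published inputs (named facts of the tree)
    (hGZ : gross_zagier (W.conductorNorm ℤ) W K) (hKo : kolyvagin (W.conductorNorm ℤ) W K)
    (hSk : Skinner2016.thmC_padicValRat_bsd_rank_zero)
    (hGZK : rank_eq_analyticRank_of_analyticRank_le_one) (hmod : hasEntireLFunction_rat)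
    -- the pair
    (hr : W.analyticRank = 1) (hp2 : p ≠ 2) (hmult : Mult W p) (hirr : Irr W p) (hram : Ram W p)
    -- the Heegner data (`d_K` odd, `p ∤ d_K`)
    (hK : IsImaginaryQuadratic K) (hodd : Odd (NumberField.discr K))
    (hpd : ¬ (p : ℤ) ∣ NumberField.discr K)
    (hHN : SatisfiesHeegnerHypothesis (W.conductorNorm ℤ) K)
    (hP : WeierstrassCurve.Affine.Point.map ι.toRatAlgHom P = heegnerPointComplex Dt H)
    (hc : ¬ (p : ℤ) ∣ Dt.c) (hμ : ¬ p ∣ Units.torsionOrder K)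
    (hLt : (W.quadraticTwist (NumberField.discr K : ℚ)).entireLFunction 1 ≠ 0)
    (Wd : WeierstrassCurve ℚ) [Wd.IsElliptic] [Wd.IsGloballyMinimal] (Cd : VariableChange ℚ)
    (hWd : Cd • W.quadraticTwist (NumberField.discr K : ℚ) = Wd) :
    (IndexLowerBoundAt W p K P → Typed.MissingLowerBoundAt W p) ∧
      (¬ p ∣ W.tamagawaProduct →
        (Finite (W.baseChange K).sha → ¬ IsOfFinAddOrder P →
          padicValNat p (Nat.card (W.baseChange K).sha) ≤
            2 * padicValNat p (AddSubgroup.zmultiples P).index) →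
        Typed.MissingUpperBoundAt W p) := by
  have hp : p.Prime := Fact.out
  have hp3 : 3 ≤ p := by have := hp.two_le; omega
  have hD0 : (NumberField.discr K : ℚ) ≠ 0 := by exact_mod_cast NumberField.discr_ne_zero K
  haveI hEt : (W.quadraticTwist (NumberField.discr K : ℚ)).IsElliptic :=
    W.isElliptic_quadraticTwist hD0
  -- transports (a)–(e) to the minimal twist model; (d) at odd `p` with `d_K` odd (eisenstein-p2)
  have hmultd : Wd.HasMultiplicativeReductionAtPrime p :=
    hasMultiplicativeReductionAtPrime_twist_of_heegner' W p K hK hHN hmult Cd hWd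
  have hirrd : Wd.HasIrreducibleModPGaloisRep p :=
    hasIrreducibleModPGaloisRep_twist_model W p K hK.1 hirr Cd hWd
  have hramd : Ram Wd p := ram_twist_of_heegner W p K hK hHN hram Cd hWd
  have htam : padicValNat p Wd.tamagawaProduct = padicValNat p W.tamagawaProduct :=
    X2.padicValNat_tamagawaProduct_twist_of_heegner_of_odd W p hp2 K hK hodd hpd hHN Cd hWd
  have hu : padicValRat p (Cd.u : ℚ) = 0 :=
    padicValRat_u_eq_zero_of_twist_minimal W p K hK hHN hmult Cd hWd
  -- the twist: `L(E^D,1) ≠ 0`, finiteness, and Skinner's Thm. C (both halves; `p ≥ 3`)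
  have hLt' : (W.quadraticTwist (NumberField.discr K : ℚ)).entireLFunction = Wd.entireLFunction := by
    rw [← hWd, entireLFunction_smul]
  have hLd1 : Wd.entireLFunction 1 ≠ 0 := by rw [← hLt']; exact hLt
  have hrd : Wd.analyticRank = 0 := (Wd.analyticRank_eq_zero_iff_holds (hmod Wd)).2 hLd1
  have hfinSd : Finite Wd.sha := (hGZK Wd (by omega)).2
  obtain ⟨qd, hqd, hvqd⟩ := hSk Wd p hp3 (Or.inr hmultd) hirrd hramd hLd1 hfinSd
  refine ⟨fun hL ↦ ?_, fun htam0 hU ↦ ?_⟩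
  · exact missingLowerBoundAt_of_indexLowerBoundAt W p (W.conductorNorm ℤ) K Dt H ι P hGZ hKo hGZK
      hmod hK hHN hP hp2 hc hμ hr hLt Wd Cd hWd hu htam ⟨qd, hqd, hvqd.symm.le⟩ (fun _ ↦ hL)
  · exact missingUpperBoundAt_of_shaIndexBound W p (W.conductorNorm ℤ) K Dt H ι P hGZ hKo hGZK
      hmod hK hHN hP hp2 hc hμ hr hLt Wd Cd hWd hu htam htam0 ⟨qd, hqd, hvqd.le⟩ hU

/-- **Kolyvagin's Tamagawa defect at fixed Heegner data with `d_K` odd — every odd prime `p`**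
(`padicValNat_shaOrder_le_add_of_heegnerData` with `5 ≤ p` replaced by `p ≠ 2` + `d_K` odd + `p ∤ d_K`):
transports (a)–(e), Skinner 2016 Thm. C for the twist (`hSk`, `p ≥ 3`) and a Kolyvagin-shape bound
over `K` (`hU`) give `#Ш(E)_an = q ∈ ℚ` with `ord_p #Ш(E) ≤ ord_p q + 2·ord_p ∏_ℓ c_ℓ(E)`.
[cite: JetchevSkinnerWan2017, §7.4.2 (p. 31) and (eq:tamK)] [cite: Skinner2016PacificMC, Thm. C (§1) and footnote 1]
[cite: Miller2011LMS, Def. 1.1] -/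
theorem padicValNat_shaOrder_le_add_of_heegnerData_of_odd
    (W : WeierstrassCurve ℚ) [W.IsElliptic] [W.IsGloballyMinimal] (p : ℕ) [Fact p.Prime]
    [NeZero (W.conductorNorm ℤ)] (K : Type) [Field K] [NumberField K]
    (Dt : ModularParametrizationData W (W.conductorNorm ℤ))
    (H : HeegnerDatum (W.conductorNorm ℤ) (NumberField.discr K)) (ι : K →+* ℂ)
    (P : (W.baseChange K).toAffine.Point)
    -- the published inputs (named facts of the tree)
    (hGZ : gross_zagier (W.conductorNorm ℤ) W K) (hKo : kolyvagin (W.conductorNorm ℤ) W K)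
    (hSk : Skinner2016.thmC_padicValRat_bsd_rank_zero)
    (hGZK : rank_eq_analyticRank_of_analyticRank_le_one) (hmod : hasEntireLFunction_rat)
    -- the pair
    (hr : W.analyticRank = 1) (hp2 : p ≠ 2) (hmult : Mult W p) (hirr : Irr W p) (hram : Ram W p)
    -- the Heegner data (`d_K` odd, `p ∤ d_K`)
    (hK : IsImaginaryQuadratic K) (hodd : Odd (NumberField.discr K))
    (hpd : ¬ (p : ℤ) ∣ NumberField.discr K)
    (hHN : SatisfiesHeegnerHypothesis (W.conductorNorm ℤ) K)
    (hP : WeierstrassCurve.Affine.Point.map ι.toRatAlgHom P = heegnerPointComplex Dt H)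
    (hc : ¬ (p : ℤ) ∣ Dt.c) (hμ : ¬ p ∣ Units.torsionOrder K)
    (hLt : (W.quadraticTwist (NumberField.discr K : ℚ)).entireLFunction 1 ≠ 0)
    (Wd : WeierstrassCurve ℚ) [Wd.IsElliptic] [Wd.IsGloballyMinimal] (Cd : VariableChange ℚ)
    (hWd : Cd • W.quadraticTwist (NumberField.discr K : ℚ) = Wd)
    -- an upper bound of Kolyvagin's shape over `K`
    (hU : Finite (W.baseChange K).sha → ¬ IsOfFinAddOrder P →
      padicValNat p (Nat.card (W.baseChange K).sha) ≤
        2 * padicValNat p (AddSubgroup.zmultiples P).index) :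
    ∃ q : ℚ, shaAn W = (q : ℂ) ∧
      (padicValNat p W.shaOrder : ℤ) ≤ padicValRat p q + 2 * padicValNat p W.tamagawaProduct := by
  have hp : p.Prime := Fact.out
  have hp3 : 3 ≤ p := by have := hp.two_le; omega
  have hD0 : (NumberField.discr K : ℚ) ≠ 0 := by exact_mod_cast NumberField.discr_ne_zero K
  haveI hEt : (W.quadraticTwist (NumberField.discr K : ℚ)).IsElliptic :=
    W.isElliptic_quadraticTwist hD0
  -- transports (a)–(e) to the minimal twist model; (d) at odd `p` with `d_K` odd (eisenstein-p2)
  have hmultd : Wd.HasMultiplicativeReductionAtPrime p :=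
    hasMultiplicativeReductionAtPrime_twist_of_heegner' W p K hK hHN hmult Cd hWd
  have hirrd : Wd.HasIrreducibleModPGaloisRep p :=
    hasIrreducibleModPGaloisRep_twist_model W p K hK.1 hirr Cd hWd
  have hramd : Ram Wd p := ram_twist_of_heegner W p K hK hHN hram Cd hWd
  have htam : padicValNat p Wd.tamagawaProduct = padicValNat p W.tamagawaProduct :=
    X2.padicValNat_tamagawaProduct_twist_of_heegner_of_odd W p hp2 K hK hodd hpd hHN Cd hWd
  have hu : padicValRat p (Cd.u : ℚ) = 0 :=
    padicValRat_u_eq_zero_of_twist_minimal W p K hK hHN hmult Cd hWd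
  -- the twist: `L(E^D,1) ≠ 0`, finiteness, and Skinner's Thm. C (`p ≥ 3`)
  have hLt' : (W.quadraticTwist (NumberField.discr K : ℚ)).entireLFunction = Wd.entireLFunction := by
    rw [← hWd, entireLFunction_smul]
  have hLd1 : Wd.entireLFunction 1 ≠ 0 := by rw [← hLt']; exact hLt
  have hrd : Wd.analyticRank = 0 := (Wd.analyticRank_eq_zero_iff_holds (hmod Wd)).2 hLd1
  have hfinSd : Finite Wd.sha := (hGZK Wd (by omega)).2
  obtain ⟨qd, hqd, hvqd⟩ := hSk Wd p hp3 (Or.inr hmultd) hirrd hramd hLd1 hfinSd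
  exact padicValNat_shaOrder_le_add_of_shaIndexBound W p (W.conductorNorm ℤ) K Dt H ι P hGZ hKo hGZK
    hmod hK hHN hP hp2 hc hμ hr hLt Wd Cd hWd hu htam ⟨qd, hqd, hvqd.le⟩ hU

/-! ### The odd-discriminant Heegner data of a pair (Hoffstein–Luo field + Manin-unit datum) -/

/-- **The route's Heegner data at an odd prime, all at once.** For `W/ℚ` globally minimal with
`ord_{s=1} L(E,s) = 1`, `p` odd multiplicative, `E[p]` irreducible: an imaginary quadratic `K` with
`d_K` ODD, `d_K < −4` (so `#𝓞_K^× = 2`, prime to `p`), every `ℓ ∣ N` and `p` split (so `p ∤ d_K`) and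
`L(E^{d_K},1) ≠ 0` — x1a's `exists_admissibleField_of_rootNumber_eq_neg_one` from Hoffstein–Luo 1997
(`hHL`) and modularity (`hnf`, sign `−1`); the Manin-unit datum `(Dt, H, ι, P)` with `p ∤ c`
(`exists_maninDatum_of_odd`: `hnf`, `hMaz`, `hNS`); and a globally minimal model `Wd = Cd • W^{(d_K)}`
of the twist (Néron; Silverman VIII.8 Cor. 8.3). Bookkeeping. [cite: HoffsteinLuo1997, Theorem (§1, pp. 435–436)]
[cite: Mazur1978, Cor. 4.1] [cite: CastellaEtAl2021, proof of Thm. 5.3.1, conditions (a)–(d)] -/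
theorem exists_oddHeegnerData (hnf : exists_isNewformOf)
    (hHL : HoffsteinLuo1997_exists_twist_L_one_ne_zero)
    (hMaz : mazur_not_dvd_maninConstant_of_odd) (hNS : integral_neronScaling_of_isGloballyMinimal)
    (W : WeierstrassCurve ℚ) [W.IsElliptic] [W.IsGloballyMinimal] (p : ℕ) [Fact p.Prime]
    [NeZero (W.conductorNorm ℤ)]
    (hr : W.analyticRank = 1) (hp2 : p ≠ 2) (hmult : Mult W p) (hirr : Irr W p) :
    ∃ (K : Type) (_ : Field K) (_ : NumberField K)
      (Dt : ModularParametrizationData W (W.conductorNorm ℤ))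
      (H : HeegnerDatum (W.conductorNorm ℤ) (NumberField.discr K)) (ι : K →+* ℂ)
      (P : (W.baseChange K).toAffine.Point)
      (Wd : WeierstrassCurve ℚ) (_ : Wd.IsElliptic) (_ : Wd.IsGloballyMinimal) (Cd : VariableChange ℚ),
      IsImaginaryQuadratic K ∧ Odd (NumberField.discr K) ∧ ¬ (p : ℤ) ∣ NumberField.discr K ∧
        SatisfiesHeegnerHypothesis (W.conductorNorm ℤ) K ∧
        WeierstrassCurve.Affine.Point.map ι.toRatAlgHom P = heegnerPointComplex Dt H ∧
        ¬ (p : ℤ) ∣ Dt.c ∧ ¬ p ∣ Units.torsionOrder K ∧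
        (W.quadraticTwist (NumberField.discr K : ℚ)).entireLFunction 1 ≠ 0 ∧
        Cd • W.quadraticTwist (NumberField.discr K : ℚ) = Wd := by
  have hp : p.Prime := Fact.out
  -- the sign of the functional equation is `−1` (modularity, `r_an = 1`)
  have hw : W.rootNumber = -1 := by
    rw [WeierstrassCurve.rootNumber_eq_neg_one_pow_analyticRank_of_exists_isNewformOf hnf W, hr]
    norm_num
  -- the Hoffstein–Luo field: `d_K ≡ 1 (mod 8)`, `d_K < −4`, every `ℓ ∣ N` and `p` split
  obtain ⟨K, _, _, hK, hodd, hlt, hHN, hHp, hLt⟩ :=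
    exists_admissibleField_of_rootNumber_eq_neg_one hnf hHL W hw p
  have hpd : ¬ (p : ℤ) ∣ NumberField.discr K := not_dvd_discr_of_split hK hp hp2 hHp
  -- `w_K = 2`, prime to the odd prime `p`
  have hμ : ¬ p ∣ Units.torsionOrder K := by
    haveI : IsTotallyComplex K := hK.2
    rw [Literature.NumberTheory.DiophantineGeometry.torsionOrder_eq_two_of_discr_lt hK.1 hlt]
    intro h2
    have := Nat.le_of_dvd two_pos h2
    have := hp.two_le
    omega
  -- the Heegner datum with `p ∤ c`
  obtain ⟨Dt, H, ι, P, hP, hc⟩ :=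
    exists_maninDatum_of_odd hnf hMaz hNS W p (W.conductorNorm ℤ) K rfl hp2 hmult hirr hK hHN
  -- a globally minimal model of the twist
  have hD0 : (NumberField.discr K : ℚ) ≠ 0 := by exact_mod_cast NumberField.discr_ne_zero K
  haveI hEt : (W.quadraticTwist (NumberField.discr K : ℚ)).IsElliptic :=
    W.isElliptic_quadraticTwist hD0
  obtain ⟨Cd, hCd⟩ := hasGlobalMinimalModel_rat_holds (W.quadraticTwist (NumberField.discr K : ℚ))
  exact ⟨K, inferInstance, inferInstance, Dt, H, ι, P, Cd • W.quadraticTwist (NumberField.discr K : ℚ),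
    inferInstance, hCd, Cd, hK, hodd, hpd, hHN, hP, hc, hμ, hLt, rfl⟩

end Summit.BirchSwinnertonDyer.Rank1Residual.X11b

end
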